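import Summits.Ventures.Crystal3D.Theorems.StickyWulffConstantNoReconstructionGainOfCertificate
import Summits.Ventures.Crystal3D.Theorems.StickyWulffConstantNoReconstructionGainCore
import Summits.Ventures.Crystal3D.Theorems.StickyWulffConstantNoReconstructionGainCertificate
import Summits.Ventures.Crystal3D.Theorems.StickyWulffConstantNoReconstructionGainCubeCap
import Summits.Ventures.Crystal3D.Theorems.StickyWulffConstantNoReconstructionGainPredSlotBudgetCone
import Summits.Ventures.Crystal3D.Theses.StickyWulffConstant
import HarnessLib

/-!
# Line `joint-level-support-bound` for the crux `NoReconstructionGain` (stmt-Ventures-19144)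

Crux (route `StickyWulffConstant`, rank 2, FIXED — concluded BY NAME below):
`Summit.Ventures.Crystal3D.Theses.StickyWulffConstant.NoReconstructionGain`.
Planner seat `planner-cruxplan-stmt-Ventures-19144-joint-level-support-bound-g0-0` (CRUX-PLAN, idea card
`Cruxes/NoReconstructionGain/Ideas/joint-level-support-bound.md`, triage r1 ×2 PASS).  Line card:
`Lines/joint_level_support_bound.md`.

## Strategy

The landed reduction chain is `noReconstructionGain_of_adhesion` (…OfCertificate) ∘ `adhesion_of_core`
(…Core): the crux follows from the *adhesion inequality restricted to cores*
`#cross(P, X \ P) ≤ contactDeficiency (X \ P) + C·ρ`, and the landed potential certificate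
`cross_le_of_potential` (…Certificate) proves adhesion with `C = 0` (plus `6·#E` for an exempted rim `E`)
as soon as every non-exempt film ball `q` satisfies the per-ball inequality (T2)
`2·#below(q) + 2·#plug(q) + #level(q) ≤ 12` for some integer potential `Φ` on the film
(`noGainPotential_iff`).

NEW LEVER: read (T2) as a *joint spherical-code inequality*.  For a unit normal `ν` and a finite set
`U ⊂ S²` of contact directions with pairwise `⟪u, w⟫ ≤ 1/2` (kissing separation) call `u` **deep** if
`⟪u, ν⟫ ≤ -1/2` and **level** if `|⟪u, ν⟫| ≤ 1/10`.  The JOINT BOUND `JB(1/2, 1/10)` says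
`2·#deep + #level ≤ 12`.  It is tight SIMULTANEOUSLY at the three F-faces of fcc — (111): (deep, level)
= (3, 6); (100): (4, 4); (110): (5, 2) — which is exactly why the Wulff constant shows no reconstruction
gain at ANY normal.  Whenever the film admits an integer LAYER INDEX `L` such that, seen from every film
ball `q`, substrate partners and lower-layer partners are `1/2`-deep and same-layer partners are
`1/10`-level (a "(1/2, 1/10)-layered film": every (111)-, (100)- or (110)-type ordered or DISORDERED
stacking aligned with the slab, rumpled by up to `1/10` per layer, at every slab normal `ν`), `JB` IS
(T2) for `Φ = L`, so the certificate gives adhesion with `C = 0` (`stub_layeredAdhesion_of_jointBound`,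
bookkeeping).  The crux is thereby reduced to its restriction to cores admitting NO such layering
(`stub_adhesion_nonLayeredCore`, the honest residual = the lead's open `stub_adhesion_core`, skeleton
v21, with one more hypothesis; `adhesion_nonLayeredCore_of_adhesion_core` records the implication).

`JB(1/2, 1/10)` itself is assembled IN THIS FILE (`jointBound_half_tenth_of_rows`, real proof) from TWO
sphere-geometry stubs and the LANDED thin-band count `card_thin_band_le_six_axis` (≤ 6 level directions):
  * `stub_jointBound_deepHeavy`  [M/L, HARDEST]: five or more deep directions are rigid — either the
    pole `-ν` plus a ring on the circle `⟪u,ν⟫ = -1/2` with azimuth gaps in `[70.5°, 77.9°]`, or five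
    ring-near directions with all gaps `≤ 77.9°` — and then `2·#deep + #level ≤ 12`, i.e. the rows
    (deep ≥ 7), (6 deep, ≥ 1 level), (5 deep, ≥ 3 level) of the joint table are empty.  Numerical
    margins (cf-p2 PREREG §44, kit job j314818, depth threshold t* below which the row becomes feasible,
    to be compared with 1/2): t*(0,7) = 0.20, t*(1,6; β=0.1) = 0.38, t*(3,5; β=0.1) = 0.404.
  * `stub_jointBound_levelHeavy` [M]: five level directions confine the deep ones to at most three
    (row (4 deep, 5 level) empty; t*(5,4; β=0.1) = 0.11).
  * the regime `#deep ≤ 4, #level ≤ 4` is free, and `#level ≤ 6` is `card_thin_band_le_six_axis`.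
Hand proofs (line card §Stubs): the azimuthal-gap method of `no_seven_in_thin_band` /
`seven_sorted_angles_false` — two non-polar deep directions are `≥ arccos(1/3) = 70.5° > 60°` apart in
azimuth, so at most five are non-polar and a sixth deep direction is the pole, forcing the others onto
`⟪u,ν⟫ = -1/2` (`inner = 1/2` with the pole); a `1/10`-level direction needs `≥ 50.3°` of azimuthal
clearance from a deep direction at `⟪u,ν⟫ = -1/2`, two level directions are `≥ 59.0°` apart.

WHY THIS IS NOVEL (search log on the idea card + TRIAGE-r1-1/2): one-sided kissing counts (Fejes Tóth
B₃ = 9 `fejesTothG1981_oneSidedKissing_three_holds`, Kertész' eight in an open hemisphere,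
`card_band_le_seven`, the landed 35°/45°-cap and thin-band counts) bound ONE region of the sphere; no
mixed weighted count `2·#(antipodal 60°-cap) + #(equatorial band) ≤ 12`, tight at three different
configurations, exists in corpus or galaxy (queries listed on the card).  Relative to the landed
steep-or-flat theorem `steepFlat_noReconstructionGain_single_two` ((111) only; depth threshold √(5/8) via
`card_negCone_le_three`; band 1/5) the joint bound lowers the depth threshold to the sharp value 1/2
((110) is tight), keeps a genuine band thickness 1/10, and works at EVERY normal, so all (111)/(100)/(110)-
type layered films — ordered, disordered or rumpled — are discharged by one inequality with `C = 0`;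
what remains is typed (`stub_adhesion_nonLayeredCore`), not hidden.

CARRIED STUBS (not used by this line's composition): `stub_adhesion_core` and
`predSlotBudget_of_upBond_raised_three` are copied VERBATIM from the lead's registered skeleton v21
(sha a14192e37b60, prover-crystal3d-wulff-p1-g14-0) so that registering this line keeps them registered
for the live lead's stub workers; `stub_adhesion_core` moreover implies this line's residual
(`adhesion_nonLayeredCore_of_adhesion_core`).

PRICES: S ≤ 1 prover-day, M = 2–4 days, L = open-ended.  Disproof.lean: none exists for this crux
(`ledger crux ls`); negatives index (`ledger negatives --problem Ventures`): nothing on spherical codes or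
layered films; dead lines honoured: belt/raft certificates (false for b < 1/(2√3), cf-p2 §45) are not used,
pointwise 1-local height profiles (cellflux CF3′ false at degree 8, 11) are not used — the level/deep
dichotomy is IMPOSED by the layer index `L`, and everything else is the residual.
-/

noncomputable section

namespace Summit.Ventures.Crystal3D.Cruxes.NoReconstructionGain.JointLevelSupportBound

open Summit.Ventures.Crystal3D Summit.Ventures.Crystal3D.Theorems Finset
open Literature.MathematicalPhysics.StatisticalMechanics (fccStacking barlowStacking barlowPos constHagg
  IsHaggSeq threeOffsets orderedContacts contactDeficiency)
open scoped InnerProductSpace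

/-! ## The two sphere-geometry stubs (joint (deep, level) table at t = 1/2, β = 1/10) -/

/-- [M/L, HARDEST] **Deep-heavy regime of the joint bound.**  If at least five directions of a
kissing-separated set `U ⊂ S²` are `1/2`-deep then `2·#deep + #level(1/10) ≤ 12`; equivalently the rows
(≥ 7 deep), (6 deep, ≥ 1 level), (5 deep, ≥ 3 level) are empty ((110) realises (5, 2), the pole + ring
realises (6, 0)).  Plan: non-polar deep directions are `≥ arccos (1/3)` apart in azimuth
(`3zz' + √(1-z²)√(1-z'²) ≥ 3/2` on `[-1,-1/2]²`), hence ≤ 5 of them (`1/3 < 1/2 = cos (2π/6)`); a sixth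
is the pole and pins the rest to `⟪u,ν⟫ = -1/2` with gaps `≤ 360° - 4·70.5°`; level directions need
azimuthal clearance `≥ 50.3°` (deep at `-1/2`) resp. `≥ 42.8°` (deep down to `-0.636`, the most the
gap budget `7.4°` allows without a pole).  Fallback: interval branch-and-bound certificate. -/
theorem stub_jointBound_deepHeavy :
    ∀ ν : EuclideanSpace ℝ (Fin 3), ‖ν‖ = 1 → ∀ U : Finset (EuclideanSpace ℝ (Fin 3)),
      (∀ u ∈ U, ‖u‖ = 1) → (∀ u ∈ U, ∀ w ∈ U, u ≠ w → ⟪u, w⟫_ℝ ≤ 1 / 2) →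
      5 ≤ (U.filter fun u => ⟪u, ν⟫_ℝ ≤ -(1 / 2)).card →
      2 * (U.filter fun u => ⟪u, ν⟫_ℝ ≤ -(1 / 2)).card
        + (U.filter fun u => |⟪u, ν⟫_ℝ| ≤ 1 / 10).card ≤ 12 := by
  sorry

/-- [M] **Level-heavy regime of the joint bound.**  Five `1/10`-level directions of a kissing-separated
set leave room for at most three `1/2`-deep ones (row (4 deep, 5 level) empty; (100) realises (4, 4)).
Plan: the five level azimuth gaps lie in `[59.0°, 124°]`; deep directions with `-⟪u,ν⟫ < 0.8116` need
clearance inside a level gap; the clearance-free cap `-⟪u,ν⟫ ≥ 0.8116` holds at most three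
(`card_negCone_le_three`-type, 0.8116² > 5/8) and such a triple is `60°`-incompatible with any fourth
deep direction.  Numerical margin t*(5,4; 0.1) = 0.11 ≪ 1/2. -/
theorem stub_jointBound_levelHeavy :
    ∀ ν : EuclideanSpace ℝ (Fin 3), ‖ν‖ = 1 → ∀ U : Finset (EuclideanSpace ℝ (Fin 3)),
      (∀ u ∈ U, ‖u‖ = 1) → (∀ u ∈ U, ∀ w ∈ U, u ≠ w → ⟪u, w⟫_ℝ ≤ 1 / 2) →
      5 ≤ (U.filter fun u => |⟪u, ν⟫_ℝ| ≤ 1 / 10).card →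
      (U.filter fun u => ⟪u, ν⟫_ℝ ≤ -(1 / 2)).card ≤ 3 := by
  sorry

/-! ## The joint bound `JB(1/2, 1/10)` assembled from the two stubs (real proof) -/

/-- **Joint level/support bound at (t, β) = (1/2, 1/10)** from the two regime stubs and the landed
thin-band count `card_thin_band_le_six_axis` (band `1/10 ≤ 1/5`). -/
theorem jointBound_half_tenth_of_rows
    (hdeep : ∀ ν : EuclideanSpace ℝ (Fin 3), ‖ν‖ = 1 → ∀ U : Finset (EuclideanSpace ℝ (Fin 3)),
      (∀ u ∈ U, ‖u‖ = 1) → (∀ u ∈ U, ∀ w ∈ U, u ≠ w → ⟪u, w⟫_ℝ ≤ 1 / 2) →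
      5 ≤ (U.filter fun u => ⟪u, ν⟫_ℝ ≤ -(1 / 2)).card →
      2 * (U.filter fun u => ⟪u, ν⟫_ℝ ≤ -(1 / 2)).card
        + (U.filter fun u => |⟪u, ν⟫_ℝ| ≤ 1 / 10).card ≤ 12)
    (hlevel : ∀ ν : EuclideanSpace ℝ (Fin 3), ‖ν‖ = 1 → ∀ U : Finset (EuclideanSpace ℝ (Fin 3)),
      (∀ u ∈ U, ‖u‖ = 1) → (∀ u ∈ U, ∀ w ∈ U, u ≠ w → ⟪u, w⟫_ℝ ≤ 1 / 2) →
      5 ≤ (U.filter fun u => |⟪u, ν⟫_ℝ| ≤ 1 / 10).card →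
      (U.filter fun u => ⟪u, ν⟫_ℝ ≤ -(1 / 2)).card ≤ 3) :
    ∀ ν : EuclideanSpace ℝ (Fin 3), ‖ν‖ = 1 → ∀ U : Finset (EuclideanSpace ℝ (Fin 3)),
      (∀ u ∈ U, ‖u‖ = 1) → (∀ u ∈ U, ∀ w ∈ U, u ≠ w → ⟪u, w⟫_ℝ ≤ 1 / 2) →
      2 * (U.filter fun u => ⟪u, ν⟫_ℝ ≤ -(1 / 2)).card
        + (U.filter fun u => |⟪u, ν⟫_ℝ| ≤ 1 / 10).card ≤ 12 := by
  classical
  intro ν hν U hU hsep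
  have hr : (U.filter fun u => |⟪u, ν⟫_ℝ| ≤ 1 / 10).card ≤ 6 :=
    card_thin_band_le_six_axis ν hν (fun u hu => hU u (mem_filter.1 hu).1)
      (fun u hu => ((mem_filter.1 hu).2).trans (by norm_num))
      (fun u hu w hw huw => hsep u (mem_filter.1 hu).1 w (mem_filter.1 hw).1 huw)
  by_cases h5 : 5 ≤ (U.filter fun u => ⟪u, ν⟫_ℝ ≤ -(1 / 2)).card
  · exact hdeep ν hν U hU hsep h5
  · by_cases r5 : 5 ≤ (U.filter fun u => |⟪u, ν⟫_ℝ| ≤ 1 / 10).card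
    · have := hlevel ν hν U hU hsep r5
      omega
    · omega

/-! ## Bookkeeping stub: the joint bound is the per-ball certificate (T2) for layered films -/

/-- [S/M] **Layered-film adhesion from the joint bound.**  If `JB(t, β)` holds and the film `X \ P`
carries an integer layer index `L` such that, from every non-exempt film ball `q` (`q ∉ E`), each
substrate partner is `t`-deep, each lower-layer partner is `t`-deep and each same-layer partner is
`β`-level (directions `y - q` against `ν`), then adhesion holds with constant `6·#E`.  Plan:
`cross_le_of_potential X P E … (Φ := L)`; at `q` map the partners `y ↦ y - q` (unit vectors, pairwise
`⟪·,·⟫ ≤ 1/2` by `inner_le_half_of_one_le_dist` and the packing condition, injective), so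
`#plug(q) + #below(q) ≤ #deep`, `#level(q) ≤ #level-directions`, and `JB` gives (T2) in the form
`noGainPotential_iff`. -/
theorem stub_layeredAdhesion_of_jointBound :
    ∀ t β : ℝ,
      (∀ ν : EuclideanSpace ℝ (Fin 3), ‖ν‖ = 1 → ∀ U : Finset (EuclideanSpace ℝ (Fin 3)),
        (∀ u ∈ U, ‖u‖ = 1) → (∀ u ∈ U, ∀ w ∈ U, u ≠ w → ⟪u, w⟫_ℝ ≤ 1 / 2) →
        2 * (U.filter fun u => ⟪u, ν⟫_ℝ ≤ -t).card
          + (U.filter fun u => |⟪u, ν⟫_ℝ| ≤ β).card ≤ 12) →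
      ∀ ν : EuclideanSpace ℝ (Fin 3), ‖ν‖ = 1 →
      ∀ X P E : Finset (EuclideanSpace ℝ (Fin 3)),
      (∀ p ∈ X, ∀ q ∈ X, p ≠ q → 1 ≤ dist p q) → P ⊆ X → E ⊆ X \ P →
      ∀ L : EuclideanSpace ℝ (Fin 3) → ℤ,
      (∀ q ∈ (X \ P) \ E, ∀ y ∈ X, dist q y = 1 →
        (y ∈ P → ⟪y - q, ν⟫_ℝ ≤ -t) ∧
        (y ∉ P → (L y = L q → |⟪y - q, ν⟫_ℝ| ≤ β) ∧ (L y < L q → ⟪y - q, ν⟫_ℝ ≤ -t))) →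
      ((((P ×ˢ (X \ P)).filter fun pq => dist pq.1 pq.2 = 1).card : ℕ) : ℝ) ≤
        contactDeficiency (X \ P) + 6 * (E.card : ℝ) := by
  sorry

/-! ## Residual stub: the crux restricted to non-layered cores -/

/-- [L = the crux's remaining core] **Adhesion for cores admitting no `(1/2, 1/10)`-layering.**  The
hypothesis list of the landed `adhesion_of_core` (= the carried `stub_adhesion_core`) with ONE MORE
hypothesis: no integer layer index `L` makes the whole film `(1/2, 1/10)`-layered over the slab sample
`P` at the normal `ν`.  Outside this class (hence already discharged by this line): every fcc / hcp /
Barlow / (100)- or (110)-stacked, ordered or disordered, `≤ 1/10`-rumpled film aligned with the slab.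
Inside: misoriented grains and genuinely 3-D-disordered minimal cores. -/
theorem stub_adhesion_nonLayeredCore :
    ∃ R C : ℝ, 1 ≤ R ∧ ∀ ν : EuclideanSpace ℝ (Fin 3), ‖ν‖ = 1 → ∀ ρ : ℝ, R ≤ ρ →
      ∀ X P : Finset (EuclideanSpace ℝ (Fin 3)),
      (∀ p ∈ X, ∀ q ∈ X, p ≠ q → 1 ≤ dist p q) → P ⊆ X →
      (∀ p, p ∈ P ↔ (p ∈ fccStacking 1 (Real.sqrt (2 / 3)) ∧ -(2 * R) ≤ ⟪p, ν⟫_ℝ ∧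
        ⟪p, ν⟫_ℝ ≤ -R ∧ ‖p‖ ^ 2 - ⟪p, ν⟫_ℝ ^ 2 ≤ ρ ^ 2)) →
      (∀ S, S ⊆ X \ P → S.Nonempty →
        contactDeficiency S < (((((X \ S) ×ˢ S).filter fun pq => dist pq.1 pq.2 = 1).card : ℕ) : ℝ)) →
      (∀ L : EuclideanSpace ℝ (Fin 3) → ℤ,
        ¬ (∀ q ∈ X \ P, ∀ y ∈ X, dist q y = 1 →
            (y ∈ P → ⟪y - q, ν⟫_ℝ ≤ -(1 / 2)) ∧
            (y ∉ P → (L y = L q → |⟪y - q, ν⟫_ℝ| ≤ 1 / 10) ∧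
              (L y < L q → ⟪y - q, ν⟫_ℝ ≤ -(1 / 2))))) →
      ((((P ×ˢ (X \ P)).filter fun pq => dist pq.1 pq.2 = 1).card : ℕ) : ℝ) ≤
        contactDeficiency (X \ P) + C * ρ := by
  sorry

/-! ## Carried stubs (verbatim from the lead's registered skeleton v21; not used by this composition) -/

/-- Carried verbatim from skeleton v21 (lead prover-crystal3d-wulff-p1-g14-0): **the adhesion atom on
cores** — the lead's open crux stub; it implies `stub_adhesion_nonLayeredCore`. -/
theorem stub_adhesion_core :
    ∃ R C : ℝ, 1 ≤ R ∧ ∀ ν : EuclideanSpace ℝ (Fin 3), ‖ν‖ = 1 → ∀ ρ : ℝ, R ≤ ρ →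
      ∀ X P : Finset (EuclideanSpace ℝ (Fin 3)),
      (∀ p ∈ X, ∀ q ∈ X, p ≠ q → 1 ≤ dist p q) → P ⊆ X →
      (∀ p, p ∈ P ↔ (p ∈ fccStacking 1 (Real.sqrt (2 / 3)) ∧ -(2 * R) ≤ ⟪p, ν⟫_ℝ ∧
        ⟪p, ν⟫_ℝ ≤ -R ∧ ‖p‖ ^ 2 - ⟪p, ν⟫_ℝ ^ 2 ≤ ρ ^ 2)) →
      (∀ S, S ⊆ X \ P → S.Nonempty →
        contactDeficiency S < (((((X \ S) ×ˢ S).filter fun pq => dist pq.1 pq.2 = 1).card : ℕ) : ℝ)) →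
      ((((P ×ˢ (X \ P)).filter fun pq => dist pq.1 pq.2 = 1).card : ℕ) : ℝ) ≤
        contactDeficiency (X \ P) + C * ρ := by
  sorry

/-- The carried crux stub implies this line's residual (one hypothesis more). -/
theorem adhesion_nonLayeredCore_of_adhesion_core
    (h : ∃ R C : ℝ, 1 ≤ R ∧ ∀ ν : EuclideanSpace ℝ (Fin 3), ‖ν‖ = 1 → ∀ ρ : ℝ, R ≤ ρ →
      ∀ X P : Finset (EuclideanSpace ℝ (Fin 3)),
      (∀ p ∈ X, ∀ q ∈ X, p ≠ q → 1 ≤ dist p q) → P ⊆ X →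
      (∀ p, p ∈ P ↔ (p ∈ fccStacking 1 (Real.sqrt (2 / 3)) ∧ -(2 * R) ≤ ⟪p, ν⟫_ℝ ∧
        ⟪p, ν⟫_ℝ ≤ -R ∧ ‖p‖ ^ 2 - ⟪p, ν⟫_ℝ ^ 2 ≤ ρ ^ 2)) →
      (∀ S, S ⊆ X \ P → S.Nonempty →
        contactDeficiency S < (((((X \ S) ×ˢ S).filter fun pq => dist pq.1 pq.2 = 1).card : ℕ) : ℝ)) →
      ((((P ×ˢ (X \ P)).filter fun pq => dist pq.1 pq.2 = 1).card : ℕ) : ℝ) ≤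
        contactDeficiency (X \ P) + C * ρ) :
    ∃ R C : ℝ, 1 ≤ R ∧ ∀ ν : EuclideanSpace ℝ (Fin 3), ‖ν‖ = 1 → ∀ ρ : ℝ, R ≤ ρ →
      ∀ X P : Finset (EuclideanSpace ℝ (Fin 3)),
      (∀ p ∈ X, ∀ q ∈ X, p ≠ q → 1 ≤ dist p q) → P ⊆ X →
      (∀ p, p ∈ P ↔ (p ∈ fccStacking 1 (Real.sqrt (2 / 3)) ∧ -(2 * R) ≤ ⟪p, ν⟫_ℝ ∧
        ⟪p, ν⟫_ℝ ≤ -R ∧ ‖p‖ ^ 2 - ⟪p, ν⟫_ℝ ^ 2 ≤ ρ ^ 2)) →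
      (∀ S, S ⊆ X \ P → S.Nonempty →
        contactDeficiency S < (((((X \ S) ×ˢ S).filter fun pq => dist pq.1 pq.2 = 1).card : ℕ) : ℝ)) →
      (∀ L : EuclideanSpace ℝ (Fin 3) → ℤ,
        ¬ (∀ q ∈ X \ P, ∀ y ∈ X, dist q y = 1 →
            (y ∈ P → ⟪y - q, ν⟫_ℝ ≤ -(1 / 2)) ∧
            (y ∉ P → (L y = L q → |⟪y - q, ν⟫_ℝ| ≤ 1 / 10) ∧
              (L y < L q → ⟪y - q, ν⟫_ℝ ≤ -(1 / 2))))) →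
      ((((P ×ˢ (X \ P)).filter fun pq => dist pq.1 pq.2 = 1).card : ℕ) : ℝ) ≤
        contactDeficiency (X \ P) + C * ρ := by
  obtain ⟨R, C, hR, h⟩ := h
  exact ⟨R, C, hR, fun ν hν ρ hρ X P hX hPX hP hcore _ => h ν hν ρ hρ X P hX hPX hP hcore⟩

/-- Carried verbatim from skeleton v21 (lead prover-crystal3d-wulff-p1-g14-0): **OPEN BRICK B1b₃**, the
pred-slot budget when some up bond is raised and the ball has three substrate contacts.  Not part of
this line; kept so that registering this line does not expire the lead's stub. -/
theorem predSlotBudget_of_upBond_raised_three :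
    ∀ A : EuclideanSpace ℝ (Fin 3) ≃ₗᵢ[ℝ] EuclideanSpace ℝ (Fin 3), ∀ ν : EuclideanSpace ℝ (Fin 3), ‖ν‖ = 1 →
      ⟪ν, A (EuclideanSpace.single (2 : Fin 3) (1 : ℝ))⟫_ℝ ≤ -(1 / 3) →
      ∀ t : ℝ, 0 < t → ∀ K : Finset (EuclideanSpace ℝ (Fin 3)), K.card ≤ 3 →
        (∀ u ∈ K, ‖u‖ = 1 ∧ ⟪u, ν⟫_ℝ ≤ -t) →
        (∀ u ∈ K, ∀ u' ∈ K, u ≠ u' →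
          ⟪u, u'⟫_ℝ = 1 / 2 ∨ ⟪u, u'⟫_ℝ = 0 ∨ ⟪u, u'⟫_ℝ = -1 / 2) →
        ∀ ε : ℤ, (ε = 1 ∨ ε = -1) →
        (∃ o ∈ threeOffsets (-ε),
          0 ≤ ⟪A (barlowPos 1 (Real.sqrt (2 / 3)) (fun _ : ℤ => ε) 1 (-o.1) (-o.2)), ν⟫_ℝ) →
        K.card = 3 →
        (K.card : ℝ) ≤
          (if (∃ u ∈ K, 1 / 2 < ⟪u, if ⟪A (barlowPos 1 (Real.sqrt (2 / 3)) constHagg 0 1 0), ν⟫_ℝ < 0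
                then A (barlowPos 1 (Real.sqrt (2 / 3)) constHagg 0 1 0)
                else -A (barlowPos 1 (Real.sqrt (2 / 3)) constHagg 0 1 0)⟫_ℝ) ∨
              ⟪(if ⟪A (barlowPos 1 (Real.sqrt (2 / 3)) constHagg 0 1 0), ν⟫_ℝ < 0
                then A (barlowPos 1 (Real.sqrt (2 / 3)) constHagg 0 1 0)
                else -A (barlowPos 1 (Real.sqrt (2 / 3)) constHagg 0 1 0)), ν⟫_ℝ ≤ -t
            then (1 : ℝ) else 0) +
          (if (∃ u ∈ K, 1 / 2 < ⟪u, if ⟪A (barlowPos 1 (Real.sqrt (2 / 3)) constHagg 0 0 1), ν⟫_ℝ < 0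
                then A (barlowPos 1 (Real.sqrt (2 / 3)) constHagg 0 0 1)
                else -A (barlowPos 1 (Real.sqrt (2 / 3)) constHagg 0 0 1)⟫_ℝ) ∨
              ⟪(if ⟪A (barlowPos 1 (Real.sqrt (2 / 3)) constHagg 0 0 1), ν⟫_ℝ < 0
                then A (barlowPos 1 (Real.sqrt (2 / 3)) constHagg 0 0 1)
                else -A (barlowPos 1 (Real.sqrt (2 / 3)) constHagg 0 0 1)), ν⟫_ℝ ≤ -t
            then (1 : ℝ) else 0) +
          (if (∃ u ∈ K, 1 / 2 < ⟪u, if ⟪A (barlowPos 1 (Real.sqrt (2 / 3)) constHagg 0 1 (-1)), ν⟫_ℝ < 0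
                then A (barlowPos 1 (Real.sqrt (2 / 3)) constHagg 0 1 (-1))
                else -A (barlowPos 1 (Real.sqrt (2 / 3)) constHagg 0 1 (-1))⟫_ℝ) ∨
              ⟪(if ⟪A (barlowPos 1 (Real.sqrt (2 / 3)) constHagg 0 1 (-1)), ν⟫_ℝ < 0
                then A (barlowPos 1 (Real.sqrt (2 / 3)) constHagg 0 1 (-1))
                else -A (barlowPos 1 (Real.sqrt (2 / 3)) constHagg 0 1 (-1))), ν⟫_ℝ ≤ -t
            then (1 : ℝ) else 0) +
          (((threeOffsets (-ε)).filter fun o =>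
            (∃ u ∈ K, 1 / 2 < ⟪u, A (barlowPos 1 (Real.sqrt (2 / 3)) (fun _ : ℤ => ε) 1 (-o.1) (-o.2))⟫_ℝ) ∨
              ⟪A (barlowPos 1 (Real.sqrt (2 / 3)) (fun _ : ℤ => ε) 1 (-o.1) (-o.2)), ν⟫_ℝ ≤ -t).card : ℝ) := by
  sorry

/-! ## Composition: the stubs imply the crux, concluded BY NAME -/

/-- **The line decides the crux.**  `NoReconstructionGain` from the four stubs of this line, each used
BY NAME (gate shape `skeleton.extra-hypothesis` forbids anonymous hypotheses): the two regime stubs give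
`JB(1/2, 1/10)` (`jointBound_half_tenth_of_rows`); by `noReconstructionGain_of_adhesion ∘
adhesion_of_core` it suffices to prove adhesion on cores with constant `max C 0`; a core admitting a
`(1/2, 1/10)`-layering `L` gets `C = 0` from `stub_layeredAdhesion_of_jointBound` with `E = ∅`; any
other core is `stub_adhesion_nonLayeredCore`.  No `sorry` in this proof; the only sorries of the file
are the six stub bodies. -/
theorem NoReconstructionGain_of :
    Summit.Ventures.Crystal3D.Theses.StickyWulffConstant.NoReconstructionGain := by
  classical
  obtain ⟨R, C, hR, hres⟩ := stub_adhesion_nonLayeredCore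
  have hJB := jointBound_half_tenth_of_rows stub_jointBound_deepHeavy stub_jointBound_levelHeavy
  refine noReconstructionGain_of_adhesion (adhesion_of_core ⟨R, max C 0, hR, ?_⟩)
  intro ν hν ρ hρ X P hX hPX hP hcore
  have hρ0 : 0 ≤ ρ := by linarith
  have hC0 : 0 ≤ max C 0 * ρ := mul_nonneg (le_max_right _ _) hρ0
  by_cases hlay : ∃ L : EuclideanSpace ℝ (Fin 3) → ℤ,
      ∀ q ∈ X \ P, ∀ y ∈ X, dist q y = 1 →
            (y ∈ P → ⟪y - q, ν⟫_ℝ ≤ -(1 / 2)) ∧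
            (y ∉ P → (L y = L q → |⟪y - q, ν⟫_ℝ| ≤ 1 / 10) ∧
              (L y < L q → ⟪y - q, ν⟫_ℝ ≤ -(1 / 2)))
  · obtain ⟨L, hL⟩ := hlay
    have h := stub_layeredAdhesion_of_jointBound (1 / 2) (1 / 10) hJB ν hν X P ∅ hX hPX
      (empty_subset _) L (fun q hq => hL q (by simpa using hq))
    simp only [card_empty, Nat.cast_zero, mul_zero, add_zero] at h
    linarith
  · have h := hres ν hν ρ hρ X P hX hPX hP hcore (fun L hL => hlay ⟨L, hL⟩)
    have hCC : C * ρ ≤ max C 0 * ρ := mul_le_mul_of_nonneg_right (le_max_left _ _) hρ0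
    linarith

end Summit.Ventures.Crystal3D.Cruxes.NoReconstructionGain.JointLevelSupportBound

end
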